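import Summits.Ventures.DiscreteObjects.Hadamard.Order334Orbits

/-!
# Hadamard 668 census, family F12 — an automorphism of order 334 or 668 of H(668) is NEGA-cyclic (kernel)

Framing: lottery ticket; floor = certified bounds/negative ranges.

Cell pub-namedobj (venture DiscreteObjects), target (H), hadamard gen 12.  Continuation of `Order334Orbits`.  Let `(π, κ, d, e)` be a
signed-permutation automorphism of a Hadamard matrix `H` of order `668` whose permutation pair `(π, κ)` has order `334`.  By
`hadamard668_order334_free` the rows and the columns each form two regular `⟨g⟩`-orbits of length `334`.  Here:
* **`hadamard668_order334_nega`**: the sign product around every cycle is `−1`: `∏_{k<334} d (π^k i) = −1` for every row `i` and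
  `∏_{k<334} e (κ^k j) = −1` for every column `j`.  Equivalently the signed permutation matrices `P, Q` with `P H Qᵀ = H` satisfy
  `P^334 = Q^334 = −I` (order `668`): the automorphism is of NEGA-cyclic (Ito / dicyclic) type, and `H` is equivalent to a `2 × 2`
  array of negacyclic `±1` blocks of order `334`.  In particular (`no_hadamard668_unsignedAut_order334`) **no Hadamard matrix of
  order 668 has a permutation automorphism (unsigned, `P H Qᵀ = H` with permutation matrices) of order 334** — the automorphism
  form of '668 = a² + b² has no solution' for two circulant blocks of order `334`.
  Proof: `g^334 = (1, 1, D, E)` forces `D i · E j = 1`, so all cycle products equal one sign `δ`.  If `δ = +1`, re-sign along the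
  orbits: `x(k, m) = (∏_{l<k} d)(∏_{l<m} e) H (π^k i₁) (κ^m j_b)` for the two column orbits `b = 1, 2` is shift-invariant and
  `334`-periodic in both variables (`two_circulant_sq_identity`, an abstract lemma on doubly periodic shift-invariant `±1` arrays
  with orthogonal rows: `(Σ_m x(0,m))² + (Σ_m y(0,m))² = 2n`), giving `a² + b² = 668`, impossible mod `16`.
* **`hadamard668_order668_cycle`**, **`hadamard668_order668_nega`**: if `(π, κ)` has order `668` then `π` and `κ` are single
  `668`-cycles (H is equivalent to a signed-circulant matrix) and the cycle sign products are `−1` (negacyclic; a circulant H(668)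
  would need `668` to be a square); no unsigned automorphism of order `668` (`no_hadamard668_unsignedAut_order668`).
* `orderOf` packaging: `hadamard668_signedAut_orderOf_334`, `hadamard668_signedAut_orderOf_668`.
So the even part of the order table reads, at the top: orders `334` and `668` occur only in nega-cyclic form (the Williamson /
Ito / two-negacirculant families searched by the cell are exactly of this type); all permutation automorphisms have order `< 334`.
Ours, not literature; no `sorry`.
-/

namespace Summit.Ventures.DiscreteObjects.Hadamard

open Finset BigOperators Matrix

open Literature.Combinatorics.Designs.GoethalsSeidel (IsHadamardMatrix)

variable {ι : Type*} [Fintype ι] [DecidableEq ι]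

section abstract

/-- row sums of a shift-invariant array that is `n`-periodic in the second variable are constant -/
lemma rowsum_const_of_shift (n : ℕ) (x : ℕ → ℕ → ℤ) (hshift : ∀ k m, x (k + 1) (m + 1) = x k m)
    (hper : ∀ k m, x k (m + n) = x k m) : ∀ k, ∑ m ∈ range n, x k m = ∑ m ∈ range n, x 0 m := by
  intro k
  induction k with
  | zero => rfl
  | succ k ih =>
    rw [← ih]
    rcases Nat.eq_zero_or_pos n with hn | hn
    · subst hn; simp
    · obtain ⟨n', rfl⟩ : ∃ n', n = n' + 1 := ⟨n - 1, by omega⟩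
      rw [Finset.sum_range_succ' (fun m => x (k + 1) m), Finset.sum_range_succ (fun m => x k m)]
      have h0 : x (k + 1) 0 = x k n' := by
        rw [← hper (k + 1) 0, zero_add, hshift]
      rw [h0, Finset.sum_congr rfl fun m _ => hshift k m]

/-- **Two-circulant identity.**  Let `x, y : ℕ → ℕ → ℤ` be `±1`-valued, shift-invariant (`x (k+1) (m+1) = x k m`) and
`n`-periodic in each variable, with `Σ_{m<n} (x 0 m · x k m + y 0 m · y k m) = 0` for `0 < k < n` (orthogonal rows of the
`n × 2n` array `[X | Y]`).  Then `(Σ_{m<n} x 0 m)² + (Σ_{m<n} y 0 m)² = 2n` (row sums are constant and equal to column sums). -/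
theorem two_circulant_sq_identity (n : ℕ) (x y : ℕ → ℕ → ℤ)
    (hx : ∀ k m, x k m = 1 ∨ x k m = -1) (hy : ∀ k m, y k m = 1 ∨ y k m = -1)
    (hxs : ∀ k m, x (k + 1) (m + 1) = x k m) (hys : ∀ k m, y (k + 1) (m + 1) = y k m)
    (hxk : ∀ k m, x (k + n) m = x k m) (hxm : ∀ k m, x k (m + n) = x k m)
    (hyk : ∀ k m, y (k + n) m = y k m) (hym : ∀ k m, y k (m + n) = y k m)
    (horth : ∀ k, 0 < k → k < n → ∑ m ∈ range n, (x 0 m * x k m + y 0 m * y k m) = 0) :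
    (∑ m ∈ range n, x 0 m) ^ 2 + (∑ m ∈ range n, y 0 m) ^ 2 = 2 * n := by
  rcases Nat.eq_zero_or_pos n with hn | hn
  · subst hn; simp
  -- row sums and column sums are constant
  have hrx := rowsum_const_of_shift n x hxs hxm
  have hry := rowsum_const_of_shift n y hys hym
  have hcx := rowsum_const_of_shift n (fun m k => x k m) (fun m k => hxs k m) (fun m k => hxk k m)
  have hcy := rowsum_const_of_shift n (fun m k => y k m) (fun m k => hys k m) (fun m k => hyk k m)
  -- row sum = column sum (double counting)
  have hxac : ∑ k ∈ range n, x k 0 = ∑ m ∈ range n, x 0 m := by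
    have h1 : ∑ k ∈ range n, ∑ m ∈ range n, x k m = n * ∑ m ∈ range n, x 0 m := by
      rw [Finset.sum_congr rfl fun k _ => hrx k, Finset.sum_const, Finset.card_range, nsmul_eq_mul]
    have h2 : ∑ k ∈ range n, ∑ m ∈ range n, x k m = n * ∑ k ∈ range n, x k 0 := by
      rw [Finset.sum_comm, Finset.sum_congr rfl fun m _ => hcx m, Finset.sum_const, Finset.card_range, nsmul_eq_mul]
    have hn0 : (n : ℤ) ≠ 0 := by exact_mod_cast hn.ne'
    exact mul_left_cancel₀ hn0 (h2.symm.trans h1)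
  have hyac : ∑ k ∈ range n, y k 0 = ∑ m ∈ range n, y 0 m := by
    have h1 : ∑ k ∈ range n, ∑ m ∈ range n, y k m = n * ∑ m ∈ range n, y 0 m := by
      rw [Finset.sum_congr rfl fun k _ => hry k, Finset.sum_const, Finset.card_range, nsmul_eq_mul]
    have h2 : ∑ k ∈ range n, ∑ m ∈ range n, y k m = n * ∑ k ∈ range n, y k 0 := by
      rw [Finset.sum_comm, Finset.sum_congr rfl fun m _ => hcy m, Finset.sum_const, Finset.card_range, nsmul_eq_mul]
    have hn0 : (n : ℤ) ≠ 0 := by exact_mod_cast hn.ne'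
    exact mul_left_cancel₀ hn0 (h2.symm.trans h1)
  -- the total T = Σ_k Σ_m (x 0 m x k m + y 0 m y k m)
  have T1 : ∑ k ∈ range n, ∑ m ∈ range n, (x 0 m * x k m + y 0 m * y k m) = 2 * n := by
    obtain ⟨n', rfl⟩ : ∃ n', n = n' + 1 := ⟨n - 1, by omega⟩
    rw [Finset.sum_range_succ']
    have hzero : ∑ k ∈ range n', ∑ m ∈ range (n' + 1), (x 0 m * x (k + 1) m + y 0 m * y (k + 1) m) = 0 :=
      Finset.sum_eq_zero fun k hk => horth (k + 1) (Nat.succ_pos k) (by simp at hk; omega)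
    rw [hzero, zero_add]
    rw [show ∑ m ∈ range (n' + 1), (x 0 m * x 0 m + y 0 m * y 0 m) = ∑ m ∈ range (n' + 1), (2 : ℤ) from
      Finset.sum_congr rfl fun m _ => by rw [pm_mul_self (hx 0 m), pm_mul_self (hy 0 m)]; norm_num]
    rw [Finset.sum_const, Finset.card_range, nsmul_eq_mul]
    push_cast; ring
  have T2 : ∑ k ∈ range n, ∑ m ∈ range n, (x 0 m * x k m + y 0 m * y k m)
      = (∑ m ∈ range n, x 0 m) * (∑ k ∈ range n, x k 0) + (∑ m ∈ range n, y 0 m) * (∑ k ∈ range n, y k 0) := by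
    rw [Finset.sum_comm]
    have e1 : ∀ m ∈ range n, ∑ k ∈ range n, (x 0 m * x k m + y 0 m * y k m)
        = x 0 m * (∑ k ∈ range n, x k 0) + y 0 m * (∑ k ∈ range n, y k 0) := by
      intro m _
      rw [Finset.sum_add_distrib, ← Finset.mul_sum, ← Finset.mul_sum, hcx m, hcy m]
    rw [Finset.sum_congr rfl e1, Finset.sum_add_distrib, ← Finset.sum_mul, ← Finset.sum_mul]
  rw [hxac, hyac] at T2
  rw [T2] at T1
  rw [← T1]; ring

/-- `668` is not a sum of two integer squares (`668 = 4 · 167`, `167 ≡ 3 (mod 4)`; checked mod `16`) -/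
theorem not_sum_two_sq_668 (a b : ℤ) : a ^ 2 + b ^ 2 ≠ 668 := by
  intro h
  have h16 : ∀ u v : ZMod 16, u ^ 2 + v ^ 2 ≠ 668 := by decide
  apply h16 (a : ZMod 16) (b : ZMod 16)
  have := congrArg (Int.cast : ℤ → ZMod 16) h
  push_cast at this
  exact this

end abstract

section cycProducts
variable (π : Equiv.Perm ι) (d : ι → ℤ)

omit [Fintype ι] [DecidableEq ι] in
/-- extending a partial cycle product by one step -/
lemma cyc_succ' (i : ι) (k : ℕ) : cyc π d i (k + 1) = cyc π d i k * d ((π ^ k) i) := by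
  unfold cyc
  rw [Finset.prod_range_succ]

omit [Fintype ι] [DecidableEq ι] in
/-- additivity of partial cycle products -/
lemma cyc_add (i : ι) (k n : ℕ) : cyc π d i (k + n) = cyc π d i k * cyc π d ((π ^ k) i) n := by
  unfold cyc
  rw [Finset.prod_range_add]
  congr 1
  refine Finset.prod_congr rfl fun l _ => ?_
  rw [pow_add, Equiv.Perm.mul_apply, perm_pow_comm_apply]

omit [Fintype ι] [DecidableEq ι] in
/-- cycle products of a power: `cyc (π^a) (cyc π d · a) i b = cyc π d i (a b)` -/
lemma cyc_pow_mul (i : ι) (a b : ℕ) : cyc (π ^ a) (fun x => cyc π d x a) i b = cyc π d i (a * b) := by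
  induction b with
  | zero => simp [cyc]
  | succ b ih =>
    rw [cyc_succ', ih, Nat.mul_succ, cyc_add, ← pow_mul]

end cycProducts

section nega
variable {H : Matrix ι ι ℤ} {π κ : Equiv.Perm ι} {d e : ι → ℤ}

/-- **Order 334 is nega-cyclic.**  For a signed automorphism `(π, κ, d, e)` of a Hadamard matrix of order `668` with
`π^334 = κ^334 = 1`, `(π², κ²) ≠ (1,1)`, `(π^167, κ^167) ≠ (1,1)`: every cycle sign product is `−1`,
`∏_{k<334} d (π^k i) = −1` and `∏_{k<334} e (κ^k j) = −1`. -/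
theorem hadamard668_order334_nega (hH : IsHadamardMatrix H) (hι : Fintype.card ι = 668) (haut : IsSignedAut H π κ d e)
    (hπ : π ^ 334 = 1) (hκ : κ ^ 334 = 1) (h2 : π ^ 2 ≠ 1 ∨ κ ^ 2 ≠ 1) (h167 : π ^ 167 ≠ 1 ∨ κ ^ 167 ≠ 1) :
    (∀ i, cyc π d i 334 = -1) ∧ (∀ j, cyc κ e j 334 = -1) := by
  have hd := haut.1
  have he := haut.2.1
  have hA := haut.2.2
  -- D i * E j = 1
  have hDE : ∀ i j, cyc π d i 334 * cyc κ e j 334 = 1 := by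
    intro i j
    have h := signedAut_pow haut 334 i j
    rw [hπ, hκ, Equiv.Perm.one_apply, Equiv.Perm.one_apply] at h
    have hne := pm_ne_zero (hH.1 i j)
    have : (cyc π d i 334 * cyc κ e j 334 - 1) * H i j = 0 := by linarith
    rcases mul_eq_zero.mp this with h0 | h0
    · linarith
    · exact (hne h0).elim
  obtain ⟨i₀⟩ : Nonempty ι := by rw [← Fintype.card_pos_iff, hι]; norm_num
  -- the case 'all cycle products are +1' is impossible
  have main : (∀ i, cyc π d i 334 = 1) → (∀ j, cyc κ e j 334 = 1) → False := by
    intro hD1 hE1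
    obtain ⟨hfr, hfc⟩ := hadamard668_order334_free hH hι haut hπ hκ h2 h167
    -- two column orbits of length 334 covering everything
    set j₁ := i₀ with hj₁def
    have hO1 : (orbFin κ 334 j₁).card = 334 := card_orbFin_of_free (hfc j₁)
    obtain ⟨j₂, hj₂⟩ : (univ \ orbFin κ 334 j₁).Nonempty := by
      rw [← Finset.card_pos, Finset.card_univ_sdiff, hO1, hι]; norm_num
    have hj₂' : j₂ ∉ orbFin κ 334 j₁ := (Finset.mem_sdiff.mp hj₂).2
    have hO2 : (orbFin κ 334 j₂).card = 334 := card_orbFin_of_free (hfc j₂)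
    have hdisj : Disjoint (orbFin κ 334 j₁) (orbFin κ 334 j₂) :=
      disjoint_orbFin_of_not_mem (by norm_num) hκ (hfc j₁) (hfc j₂) (fun y _ => hfc y) hj₂'
    have hunion : orbFin κ 334 j₁ ∪ orbFin κ 334 j₂ = univ :=
      Finset.eq_univ_of_card _ (by rw [Finset.card_union_of_disjoint hdisj, hO1, hO2, hι])
    -- the re-signed blocks as functions of exponents
    set x : ℕ → ℕ → ℤ := fun k m => cyc π d i₀ k * cyc κ e j₁ m * H ((π ^ k) i₀) ((κ ^ m) j₁) with hxdef
    set y : ℕ → ℕ → ℤ := fun k m => cyc π d i₀ k * cyc κ e j₂ m * H ((π ^ k) i₀) ((κ ^ m) j₂) with hydef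
    have hpm : ∀ (j : ι) (k m : ℕ), cyc π d i₀ k * cyc κ e j m * H ((π ^ k) i₀) ((κ ^ m) j) = 1 ∨
        cyc π d i₀ k * cyc κ e j m * H ((π ^ k) i₀) ((κ ^ m) j) = -1 := by
      intro j k m
      rcases cyc_pm π d hd i₀ k with h1 | h1 <;> rcases cyc_pm κ e he j m with h2 | h2 <;>
        rcases hH.1 ((π ^ k) i₀) ((κ ^ m) j) with h3 | h3 <;> simp [h1, h2, h3]
    have hshift : ∀ (j : ι) (k m : ℕ), cyc π d i₀ (k + 1) * cyc κ e j (m + 1) * H ((π ^ (k + 1)) i₀) ((κ ^ (m + 1)) j)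
        = cyc π d i₀ k * cyc κ e j m * H ((π ^ k) i₀) ((κ ^ m) j) := by
      intro j k m
      rw [cyc_succ', cyc_succ', pow_succ', pow_succ', Equiv.Perm.mul_apply, Equiv.Perm.mul_apply, hA]
      have h1 := pm_mul_self (hd ((π ^ k) i₀))
      have h2 := pm_mul_self (he ((κ ^ m) j))
      calc cyc π d i₀ k * d ((π ^ k) i₀) * (cyc κ e j m * e ((κ ^ m) j)) *
            (d ((π ^ k) i₀) * e ((κ ^ m) j) * H ((π ^ k) i₀) ((κ ^ m) j))
          = (d ((π ^ k) i₀) * d ((π ^ k) i₀)) * (e ((κ ^ m) j) * e ((κ ^ m) j)) *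
            (cyc π d i₀ k * cyc κ e j m * H ((π ^ k) i₀) ((κ ^ m) j)) := by ring
        _ = cyc π d i₀ k * cyc κ e j m * H ((π ^ k) i₀) ((κ ^ m) j) := by rw [h1, h2, one_mul, one_mul]
    have hperk : ∀ (j : ι) (k m : ℕ), cyc π d i₀ (k + 334) * cyc κ e j m * H ((π ^ (k + 334)) i₀) ((κ ^ m) j)
        = cyc π d i₀ k * cyc κ e j m * H ((π ^ k) i₀) ((κ ^ m) j) := by
      intro j k m
      rw [cyc_add, hD1, mul_one, pow_add, hπ, mul_one]
    have hperm : ∀ (j : ι) (k m : ℕ), cyc π d i₀ k * cyc κ e j (m + 334) * H ((π ^ k) i₀) ((κ ^ (m + 334)) j)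
        = cyc π d i₀ k * cyc κ e j m * H ((π ^ k) i₀) ((κ ^ m) j) := by
      intro j k m
      rw [cyc_add, hE1, mul_one, pow_add, hκ, mul_one]
    -- orthogonality of the rows i₀ and π^k i₀, summed over the two column orbits
    have horth : ∀ k, 0 < k → k < 334 → ∑ m ∈ range 334, (x 0 m * x k m + y 0 m * y k m) = 0 := by
      intro k hk0 hk
      have hrow := hadamard_row_orth H hH (Ne.symm (hfr i₀ k hk0 hk))   -- Σ_j H i₀ j * H (π^k i₀) j = 0
      rw [← Finset.sum_filter_add_sum_filter_not univ (fun j => j ∈ orbFin κ 334 j₁)] at hrow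
      have hf1 : univ.filter (fun j => j ∈ orbFin κ 334 j₁) = orbFin κ 334 j₁ := by
        ext j; simp
      have hf2 : univ.filter (fun j => ¬ j ∈ orbFin κ 334 j₁) = orbFin κ 334 j₂ := by
        ext j
        simp only [Finset.mem_filter, Finset.mem_univ, true_and]
        constructor
        · intro hj
          have : j ∈ orbFin κ 334 j₁ ∪ orbFin κ 334 j₂ := by rw [hunion]; exact Finset.mem_univ j
          rcases Finset.mem_union.mp this with h | h
          · exact absurd h hj
          · exact h
        · intro hj h1
          exact Finset.disjoint_left.mp hdisj h1 hj
      rw [hf1, hf2, sum_orbFin_of_free (hfc j₁), sum_orbFin_of_free (hfc j₂)] at hrow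
      have key : ∀ (j : ι) (m : ℕ), x 0 m * x k m = 0 ∨ True := fun _ _ => Or.inr trivial
      have e1 : ∀ (j : ι) (m : ℕ),
          (cyc π d i₀ 0 * cyc κ e j m * H ((π ^ 0) i₀) ((κ ^ m) j)) * (cyc π d i₀ k * cyc κ e j m * H ((π ^ k) i₀) ((κ ^ m) j))
          = cyc π d i₀ k * (H i₀ ((κ ^ m) j) * H ((π ^ k) i₀) ((κ ^ m) j)) := by
        intro j m
        have h0 : cyc π d i₀ 0 = 1 := by simp [cyc]
        have h2 := pm_mul_self (cyc_pm κ e he j m)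
        rw [h0, pow_zero, Equiv.Perm.one_apply]
        calc 1 * cyc κ e j m * H i₀ ((κ ^ m) j) * (cyc π d i₀ k * cyc κ e j m * H ((π ^ k) i₀) ((κ ^ m) j))
            = (cyc κ e j m * cyc κ e j m) * (cyc π d i₀ k * (H i₀ ((κ ^ m) j) * H ((π ^ k) i₀) ((κ ^ m) j))) := by ring
          _ = _ := by rw [h2, one_mul]
      simp only [hxdef, hydef]
      rw [Finset.sum_add_distrib, Finset.sum_congr rfl fun m _ => e1 j₁ m, Finset.sum_congr rfl fun m _ => e1 j₂ m,
        ← Finset.mul_sum, ← Finset.mul_sum, ← mul_add, hrow, mul_zero]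
    have hsq := two_circulant_sq_identity 334 x y (fun k m => hpm j₁ k m) (fun k m => hpm j₂ k m)
      (fun k m => hshift j₁ k m) (fun k m => hshift j₂ k m) (fun k m => hperk j₁ k m) (fun k m => hperm j₁ k m)
      (fun k m => hperk j₂ k m) (fun k m => hperm j₂ k m) horth
    exact not_sum_two_sq_668 _ _ (by rw [hsq]; norm_num)
  -- conclude: all products are −1
  have hD : ∀ i, cyc π d i 334 = -1 := by
    intro i
    rcases cyc_pm π d hd i 334 with h | h
    · exfalso
      have hE1 : ∀ j, cyc κ e j 334 = 1 := by
        intro j; have := hDE i j; rw [h, one_mul] at this; exact this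
      have hD1 : ∀ i', cyc π d i' 334 = 1 := by
        intro i'; have := hDE i' i₀; rw [hE1 i₀, mul_one] at this; exact this
      exact main hD1 hE1
    · exact h
  refine ⟨hD, fun j => ?_⟩
  have := hDE i₀ j
  rw [hD i₀] at this
  linarith [cyc_pm κ e he j 334]

/-- **No permutation automorphism of order 334.**  A Hadamard matrix of order `668` has no UNSIGNED automorphism pair
`(π, κ)` (`H (π i) (κ j) = H i j`) with `π^334 = κ^334 = 1`, `(π², κ²) ≠ (1,1)`, `(π^167, κ^167) ≠ (1,1)`. -/
theorem no_hadamard668_unsignedAut_order334 (hH : IsHadamardMatrix H) (hι : Fintype.card ι = 668)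
    (hA : ∀ i j, H (π i) (κ j) = H i j)
    (hπ : π ^ 334 = 1) (hκ : κ ^ 334 = 1) (h2 : π ^ 2 ≠ 1 ∨ κ ^ 2 ≠ 1) (h167 : π ^ 167 ≠ 1 ∨ κ ^ 167 ≠ 1) : False := by
  have haut : IsSignedAut H π κ (fun _ => 1) (fun _ => 1) :=
    ⟨fun _ => Or.inl rfl, fun _ => Or.inl rfl, fun i j => by rw [hA i j]; ring⟩
  obtain ⟨i⟩ : Nonempty ι := by rw [← Fintype.card_pos_iff, hι]; norm_num
  have h := (hadamard668_order334_nega hH hι haut hπ hκ h2 h167).1 i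
  have h1 : cyc π (fun _ => (1 : ℤ)) i 334 = 1 := by simp [cyc]
  rw [h1] at h
  norm_num at h

end nega

section order668
variable {H : Matrix ι ι ℤ} {π κ : Equiv.Perm ι} {d e : ι → ℤ}

/-- **Order 668 is negacyclic.**  For a signed automorphism with `π^668 = κ^668 = 1`, `(π⁴, κ⁴) ≠ (1,1)` and
`(π^334, κ^334) ≠ (1,1)` (i.e. `(π, κ)` of order `668`): `π^334`, `κ^334` are fixed-point-free and the cycle sign products over
`668` steps are `−1`. -/
theorem hadamard668_order668_nega (hH : IsHadamardMatrix H) (hι : Fintype.card ι = 668) (haut : IsSignedAut H π κ d e)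
    (hπ : π ^ 668 = 1) (hκ : κ ^ 668 = 1) (h4 : π ^ 4 ≠ 1 ∨ κ ^ 4 ≠ 1) (h334 : π ^ 334 ≠ 1 ∨ κ ^ 334 ≠ 1) :
    ((∀ i, (π ^ 334) i ≠ i) ∧ (∀ j, (κ ^ 334) j ≠ j)) ∧ (∀ i, cyc π d i 668 = -1) ∧ (∀ j, cyc κ e j 668 = -1) := by
  have haut2 : IsSignedAut H (π ^ 2) (κ ^ 2) (fun i => cyc π d i 2) (fun j => cyc κ e j 2) := isSignedAut_pow haut 2
  have hπ2 : (π ^ 2) ^ 334 = 1 := by rw [← pow_mul]; exact hπ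
  have hκ2 : (κ ^ 2) ^ 334 = 1 := by rw [← pow_mul]; exact hκ
  have h2' : (π ^ 2) ^ 2 ≠ 1 ∨ (κ ^ 2) ^ 2 ≠ 1 := by rw [← pow_mul, ← pow_mul]; exact h4
  have h167' : (π ^ 2) ^ 167 ≠ 1 ∨ (κ ^ 2) ^ 167 ≠ 1 := by rw [← pow_mul, ← pow_mul]; exact h334
  obtain ⟨hr, hc⟩ := hadamard668_order334_fpf hH hι haut2 hπ2 hκ2 h2' h167'
  obtain ⟨hD, hE⟩ := hadamard668_order334_nega hH hι haut2 hπ2 hκ2 h2' h167'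
  refine ⟨⟨fun i => by rw [← pow_mul] at hr; exact hr i, fun j => by rw [← pow_mul] at hc; exact hc j⟩, fun i => ?_, fun j => ?_⟩
  · rw [← cyc_pow_mul π d i 2 334]; exact hD i
  · rw [← cyc_pow_mul κ e j 2 334]; exact hE j

/-- **Order 668: single cycles.**  Under the same hypotheses `π` and `κ` are `668`-cycles: `π^k`, `κ^k` have no fixed point for
`0 < k < 668` (so `H` is equivalent to a signed-circulant — by `hadamard668_order668_nega`, negacyclic — matrix of order 668). -/
theorem hadamard668_order668_cycle (hH : IsHadamardMatrix H) (hι : Fintype.card ι = 668) (haut : IsSignedAut H π κ d e)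
    (hπ : π ^ 668 = 1) (hκ : κ ^ 668 = 1) (h4 : π ^ 4 ≠ 1 ∨ κ ^ 4 ≠ 1) (h334 : π ^ 334 ≠ 1 ∨ κ ^ 334 ≠ 1) :
    (∀ i k, 0 < k → k < 668 → (π ^ k) i ≠ i) ∧ (∀ j k, 0 < k → k < 668 → (κ ^ k) j ≠ j) := by
  have hcard : (Fintype.card ι : ℤ) ≠ 0 := by rw [hι]; norm_num
  obtain ⟨⟨hr, hc⟩, -, -⟩ := hadamard668_order668_nega hH hι haut hπ hκ h4 h334
  -- g⁴ has order 167: π⁴, κ⁴ are fixed-point-free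
  have h167 := hadamard668_fixedRows_167 hH hι (π ^ 4) (κ ^ 4) _ _ (isSignedAut_pow haut 4)
    (by rw [← pow_mul]; exact hπ) (by rw [← pow_mul]; exact hκ) h4
  have fpf4 : ∀ (σ : Equiv.Perm ι), (univ.filter fun i => (σ ^ 4) i = i).card = 0 → ∀ i, (σ ^ 4) i ≠ i := by
    intro σ h0 i hi
    have hmem : i ∈ univ.filter (fun i => (σ ^ 4) i = i) := by simp [hi]
    rw [Finset.card_eq_zero.mp h0] at hmem
    simp at hmem
  have key : ∀ (σ : Equiv.Perm ι), σ ^ 668 = 1 → (∀ i, (σ ^ 334) i ≠ i) → (∀ i, (σ ^ 4) i ≠ i) →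
      ∀ i k, 0 < k → k < 668 → (σ ^ k) i ≠ i := by
    intro σ hσ h334' h4' i k hk0 hk hfix
    by_cases hdvd : 167 ∣ k
    · obtain ⟨t, rfl⟩ := hdvd
      have ht : t = 1 ∨ t = 2 ∨ t = 3 := by omega
      rcases ht with rfl | rfl | rfl
      · exact h334' i (by rw [show (334 : ℕ) = 167 * 1 * 2 from rfl, pow_mul]; exact perm_pow_apply_of_fixed _ hfix 2)
      · exact h334' i hfix
      · -- (σ^501)^3 = σ^1503 = σ^(668·2) σ^167
        have h3 : (σ ^ (167 * 3 * 3)) i = i := by rw [pow_mul]; exact perm_pow_apply_of_fixed _ hfix 3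
        have e1 : σ ^ (167 * 3 * 3) = σ ^ 167 := by
          rw [show 167 * 3 * 3 = 668 * 2 + 167 from rfl, pow_add, pow_mul, hσ, one_pow, one_mul]
        rw [e1] at h3
        exact h334' i (by rw [show (334 : ℕ) = 167 * 2 from rfl, pow_mul]; exact perm_pow_apply_of_fixed _ h3 2)
    · have hcop : Nat.Coprime k 167 := (Nat.Prime.coprime_iff_not_dvd (by norm_num)).mpr hdvd |>.symm
      have h1 : ((σ ^ 4) ^ k) i = i := by
        rw [← pow_mul, mul_comm, pow_mul]
        exact perm_pow_apply_of_fixed _ hfix 4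
      have h2 : ((σ ^ 4) ^ 167) i = i := by
        rw [← pow_mul, show 4 * 167 = 668 from rfl, hσ, Equiv.Perm.one_apply]
      exact h4' i (perm_fixed_of_pow_coprime (σ ^ 4) hcop (by norm_num) h1 h2)
  exact ⟨key π hπ hr (fpf4 π h167.1), key κ hκ hc (fpf4 κ h167.2.1)⟩

/-- **No permutation automorphism of order 668** (a circulant Hadamard matrix of order 668 would need 668 to be a square; here it
drops out of the nega-cyclic sign condition). -/
theorem no_hadamard668_unsignedAut_order668 (hH : IsHadamardMatrix H) (hι : Fintype.card ι = 668)
    (hA : ∀ i j, H (π i) (κ j) = H i j)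
    (hπ : π ^ 668 = 1) (hκ : κ ^ 668 = 1) (h4 : π ^ 4 ≠ 1 ∨ κ ^ 4 ≠ 1) (h334 : π ^ 334 ≠ 1 ∨ κ ^ 334 ≠ 1) : False := by
  have haut : IsSignedAut H π κ (fun _ => 1) (fun _ => 1) :=
    ⟨fun _ => Or.inl rfl, fun _ => Or.inl rfl, fun i j => by rw [hA i j]; ring⟩
  obtain ⟨i⟩ : Nonempty ι := by rw [← Fintype.card_pos_iff, hι]; norm_num
  have h := (hadamard668_order668_nega hH hι haut hπ hκ h4 h334).2.1 i
  have h1 : cyc π (fun _ => (1 : ℤ)) i 668 = 1 := by simp [cyc]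
  rw [h1] at h
  norm_num at h

end order668

section orderOf
variable {H : Matrix ι ι ℤ} {π κ : Equiv.Perm ι} {d e : ι → ℤ}

/-- **Order form, 334.**  If the permutation pair of a signed automorphism of a Hadamard matrix of order `668` has order `334`,
then `π^167`, `κ^167` are fixed-point-free (two row orbits and two column orbits of length `334`) and every cycle sign product
is `−1` (nega-cyclic type). -/
theorem hadamard668_signedAut_orderOf_334 (hH : IsHadamardMatrix H) (hι : Fintype.card ι = 668)
    (π κ : Equiv.Perm ι) (d e : ι → ℤ) (haut : IsSignedAut H π κ d e)
    (hord : orderOf ((π, κ) : Equiv.Perm ι × Equiv.Perm ι) = 334) :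
    ((∀ i, (π ^ 167) i ≠ i) ∧ (∀ j, (κ ^ 167) j ≠ j)) ∧ (∀ i, cyc π d i 334 = -1) ∧ (∀ j, cyc κ e j 334 = -1) := by
  obtain ⟨hπ, hκ, h2⟩ := pow_data_of_orderOf hord (a := 2) (by norm_num) (by norm_num)
  obtain ⟨-, -, h167⟩ := pow_data_of_orderOf hord (a := 167) (by norm_num) (by norm_num)
  exact ⟨hadamard668_order334_fpf hH hι haut hπ hκ h2 h167, hadamard668_order334_nega hH hι haut hπ hκ h2 h167⟩

/-- **Order form, 668.**  If the permutation pair has order `668`, then `π`, `κ` are single `668`-cycles and the cycle sign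
products are `−1` (H is equivalent to a negacyclic matrix). -/
theorem hadamard668_signedAut_orderOf_668 (hH : IsHadamardMatrix H) (hι : Fintype.card ι = 668)
    (π κ : Equiv.Perm ι) (d e : ι → ℤ) (haut : IsSignedAut H π κ d e)
    (hord : orderOf ((π, κ) : Equiv.Perm ι × Equiv.Perm ι) = 668) :
    ((∀ i k, 0 < k → k < 668 → (π ^ k) i ≠ i) ∧ (∀ j k, 0 < k → k < 668 → (κ ^ k) j ≠ j)) ∧
    (∀ i, cyc π d i 668 = -1) ∧ (∀ j, cyc κ e j 668 = -1) := by
  obtain ⟨hπ, hκ, h4⟩ := pow_data_of_orderOf hord (a := 4) (by norm_num) (by norm_num)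
  obtain ⟨-, -, h334⟩ := pow_data_of_orderOf hord (a := 334) (by norm_num) (by norm_num)
  obtain ⟨-, hD, hE⟩ := hadamard668_order668_nega hH hι haut hπ hκ h4 h334
  exact ⟨hadamard668_order668_cycle hH hι haut hπ hκ h4 h334, hD, hE⟩

/-- **Unsigned summary.**  No Hadamard matrix of order `668` has a permutation automorphism pair `(π, κ)` of order `334` or `668`. -/
theorem no_hadamard668_unsignedAut_orderOf_334_668 (hH : IsHadamardMatrix H) (hι : Fintype.card ι = 668)
    (hA : ∀ i j, H (π i) (κ j) = H i j)
    (hord : orderOf ((π, κ) : Equiv.Perm ι × Equiv.Perm ι) = 334 ∨ orderOf ((π, κ) : Equiv.Perm ι × Equiv.Perm ι) = 668) :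
    False := by
  rcases hord with h | h
  · obtain ⟨hπ, hκ, h2⟩ := pow_data_of_orderOf h (a := 2) (by norm_num) (by norm_num)
    obtain ⟨-, -, h167⟩ := pow_data_of_orderOf h (a := 167) (by norm_num) (by norm_num)
    exact no_hadamard668_unsignedAut_order334 hH hι hA hπ hκ h2 h167
  · obtain ⟨hπ, hκ, h4⟩ := pow_data_of_orderOf h (a := 4) (by norm_num) (by norm_num)
    obtain ⟨-, -, h334⟩ := pow_data_of_orderOf h (a := 334) (by norm_num) (by norm_num)
    exact no_hadamard668_unsignedAut_order668 hH hι hA hπ hκ h4 h334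

end orderOf

end Summit.Ventures.DiscreteObjects.Hadamard
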